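import Summits.QuantumFields.BalabanUV.Beta.D1BFx.LocalVertexBound

/-!
# `BalabanUV.Beta.D1BFx.LocalVertexByParts` — road «BF-x» for binder row D1, slot (K), END row `hGrp gN`, «GN-T12 ∕ FRAME-Σ»: THE SUMMED FRAME OF THE
# `SbT` PIECES WITH SUMMATION BY PARTS IN THE (1.22) VARIABLE — a row step of the list is a TOTAL difference in the base point minus a column step,
# `Σ'_w W(w)·[E(b+w+a) − E(b+w)] = Σ'_w (W(w−a) − W(w))·E(b+w)`, hence
# `|Σ'_w W(w)·biBubble A (SbT κ (b+w)) B (φ ⊗ ψ)| ≤ K·Σ'_w (|W(w)|·Φ₀(w)·Γ₁(w) + W₁(w)·Φ₀(w)·Γ₀(w))`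
# with the BAD end entering through its window VALUES `Φ₀` only (no difference of the bad end is ever needed), the GOOD end through `Γ₀ ∕ Γ₁`

HONEST DEPENDENCY (cell records, verbatim): «continuum YM on T⁴ ⇐ BetaPertH ∧ nine spine estimates (0/9 proved); BetaPertH ⇐ (D1) ∧ (D4) ∧
CAP+tail; G-an2-4 gates asym, D1 and NE2/3/4.»  HONEST FRAMING (cell contract, verbatim): «discharging `BetaPertH` makes Bałaban's UV stability
UNCONDITIONAL — a real constructive-QFT result; it is NOT the continuum limit and NOT the Clay problem.»  THIS MODULE DISCHARGES NOTHING of the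
wall: [folklore] finite bookkeeping and `tsum` algebra (shift by `Equiv.addRight`) over the owner's «GN-T12 ∕ FRAME» (`LocalVertexForm`: `vtx`, `iterΔ`,
`fdiffB`, `shiftB`, `VTerm`, `VTerm.eval`, `exists_vterms_of_graded`, `biBubble_realK_outer`; `LocalVertexBound`: `abs_iterΔ_cons_le`, `abs_sum_sum_mul_mul_le`,
`supNorm_add_step_sub_le`, the list-sum helpers), an3's `Graded` ∕ `IsStep` (`GradedBubbles`), leaf-03-g4's `CrossERestLists.graded_trStn`,
`WilsonStencilRealised.trStn`, leaf-03-g12's `GluonBubbleTails.SbT_eq_realK` ∕ `graded_SbT_list`.  No `def`, no `def … : Prop`, nothing cited, no hypothesis is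
a printed statement, 0 sorry.  Asserts NO bound on any table of the road: the window majorants `Φ₀ Γ₀ Γ₁`, the weight `W` and its step modulus `W₁` are
HYPOTHESES.  Root-level binders hW ∕ hR-sockets ∕ hSX-socket ∕ D1Tel ∕ D1Rep — 0 discharged; (K) NOT closed; NOT D1, NOT `BetaPertH`, NOT continuum, NOT Clay.

ABSOLUTE RULE (cell charter, verbatim): «No internally-minted statement may enter as a cited fact. Every hypothesis is either kernel-proved in
this package or a verbatim quotation of a PUBLISHED theorem with page reference. The manuscript(s) under audit are NOT citable for their own
disputed steps — they are the thing under adjudication; programme-internal (2001/route/tribunal) claims are never citable.»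

WHY (FINDING F-d1leaf03g13-1, journal 2026-08-21 ≈12:08Z; owner records `GLUON-NEEDLE-ROWS.md` v0.2 «GN-CELLS» row «T₁∕T₂ K-piece»).  The K-piece
`SbT ⊗ dip` of T₁ carries the weight `cK = cgh·n²`, so its cell must be `O(n⁻²)`.  On the owner's POINTWISE frame `exists_SbT_outer_bound`
(`K·(Φ₁Γ₀ + Φ₀Γ₁ + Φ₁Γ₁)`) the placement «the list's one difference on the COULOMB end `Ga∇δρ_b`, the flat end `Ga∇p_b` undifferentiated» needs
the true-scaling d1 profile `n⁻²·e∕nrm³` of `Ga∇δρ_b`, a d2-class letter for `RG` the tree does not hold (leaf-04-g9 `PairingByParts`: «its GRADIENT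
has no r⁻⁴ letter»); with the available `Φ₁ ≤ 2Φ₀ ≍ n⁻²e∕nrm²` that placement reads `Σ_w nrm²·n⁻²E₂·kC n⁻³ ≍ n⁻¹`, i.e. `cK·cell ≍ cgh·n¹`.  Summation
by parts in `w` moves the list's row step OFF the bad end: `vtx z (rowDiff a L) F G = [vtx (z+a) L F G − vtx z L F G] − vtx z L (shiftB a F) (fdiffB a G)`
(exact), and against the (1.22) weight the total difference costs `|W(w−a) − W(w)| ≤ 3·nrm(w)` instead of `nrm(w)²`: the bad placement becomes
`nrm·Φ₀Γ₀ ⇒ n⁻⁵Σ_w e∕nrm ≍ n⁻²` and the rest is `nrm²·Φ₀Γ₁ ⇒ n⁻⁶Σ_w e ≍ n⁻²` — flat with d1-class letters only.  This file is that frame, generic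
in the list (any `Graded 1`), in both orientations (`colGood`: the column end `Bφ` is the good end; `rowGood`: the row end `ψA`, via the transpose
`trStn`), instantiated for `SbT`.
* §1 [folklore] term surgery: `fdiffB_comm`, `iterΔ_fdiffB`, **`eval_eq_of_sF_cons`** (`t.eval z = t♭.eval (z+a) − t♭.eval z − t♯.eval z` for
  `t.sF = a :: s`, `t♭ := {t with sF := s}`, `t♯ := {t with x := x+a, sF := s, sG := a :: sG}` — record literals, no definition), `eval_neg_c`.
* §2 [folklore] **`exists_colGood_of_graded_one`**: a `Graded 1` list unfolds into DIRECT terms (each with a column step) and BY-PARTS pairs `(a, t)`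
  (`t.eval (z+a) − t.eval z`), all steps unit.
* §3 [folklore] bounds from window VALUES: `abs_iterΔ_le_pow_sup` (`|Δ_s F| ≤ 2^{|s|}·Φ₀`), `abs_eval_le_sup` (`Φ₀Γ₀`), **`abs_eval_le_colStep`** (`Φ₀Γ₁`).
PART 2 (`LocalVertexByPartsSum`): the `tsum` bookkeeping, the summed frames `exists_tsum_bound_colGood∕rowGood` of any `Graded 1` list and the
`SbT` instances `exists_SbT_outer_tsum_bound_colGood∕rowGood`.
NOT HERE (honest): any letter, any weight, any cell, any `tsum`.
Unit `b2b-balaban-beta-d1-formalise-leaf-03` (gen 13), D1 formalisation swarm, road «BF-x»; `LEAVES-BFx.md` row (N) «GN-K» (frame, part 1 of 2).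
-/

noncomputable section

namespace Summit.QuantumFields.BalabanUV.Beta.D1BFx.LocalVertexByParts

open Finset
open scoped BigOperators
open Literature.MathematicalPhysics.QuantumFieldTheory.Balaban1983to89
open Literature.MathematicalPhysics.QuantumFieldTheory.Balaban1983to89.Beta
open ExpKernelCalculus (Site MKer)
open DyadicShell (Pt supNorm)
open BubbleTransfer (unitVec)
open GradedBubbles (LP Stn rowSh colSh smulS rowDiff colDiff Graded IsStep)
open Summit.QuantumFields.BalabanUV.Beta.D1BFx.StencilRealisation (realK)
open Summit.QuantumFields.BalabanUV.Beta.D1BFx.WilsonStencilRealised (trStn reixStn ιU)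
open Summit.QuantumFields.BalabanUV.Beta.D1BFx.CrossERestLists (graded_trStn)
open Summit.QuantumFields.BalabanUV.Beta.D1BFx.SectorRecut (SbT)
open Summit.QuantumFields.BalabanUV.Beta.D1BFx.GluonBubbleTails (SbT_eq_realK graded_SbT_list)
open Summit.QuantumFields.BalabanUV.Beta.D1BFx.PackedKernelSplit (biBubble)
open Summit.QuantumFields.BalabanUV.Beta.D1BFx.RankOneBubble (outer applyK applyKT)
open Summit.QuantumFields.BalabanUV.Beta.D1BFx.LocalVertexForm (shiftB fdiffB iterΔ vtx VTerm shiftB_apply fdiffB_apply iterΔ_nil iterΔ_cons vtx_nil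
  vtx_cons exists_vterms_of_graded biBubble_realK_outer supNorm_add_step_sub_le abs_iterΔ_cons_le abs_sum_sum_mul_mul_le list_abs_sum_le
  list_sum_le_sum list_sum_nonneg list_le_sum_nat)

variable {I : Type*} [Fintype I]

/-! ## §1 Term surgery: a row step is a total difference in the base point minus a column step -/

section Surgery

omit [Fintype I] in
/-- [folklore] Forward differences along two vectors commute. -/
theorem fdiffB_comm (a b : Pt) (F : Pt → I → ℝ) : fdiffB a (fdiffB b F) = fdiffB b (fdiffB a F) := by
  funext x g
  simp only [fdiffB_apply, add_right_comm x a b]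
  ring

omit [Fintype I] in
/-- [folklore] Iterated differences commute with one more difference. -/
theorem iterΔ_fdiffB (s : List Pt) (a : Pt) (F : Pt → I → ℝ) : iterΔ s (fdiffB a F) = fdiffB a (iterΔ s F) := by
  induction s generalizing F with
  | nil => rfl
  | cons b s ih => rw [iterΔ_cons, iterΔ_cons, fdiffB_comm, ih]

/-- [folklore] **A ROW STEP IS A TOTAL DIFFERENCE IN THE BASE POINT MINUS A COLUMN STEP** (term level, exact): for an unfolded term `t` whose row-step
list is `a :: s`, with `t♭ := {t with sF := s}` (the step removed) and `t♯ := {t with x := t.x + a, sF := s, sG := a :: t.sG}` (the step moved to the column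
end, the row site shifted), `t.eval z F G = t♭.eval (z + a) F G − t♭.eval z F G − t♯.eval z F G`. -/
theorem eval_eq_of_sF_cons (t : VTerm I) {a : Pt} {s : List Pt} (h : t.sF = a :: s) (z : Pt) (F G : Pt → I → ℝ) :
    t.eval z F G = ({ t with sF := s } : VTerm I).eval (z + a) F G - ({ t with sF := s } : VTerm I).eval z F G
      - ({ t with x := t.x + a, sF := s, sG := a :: t.sG } : VTerm I).eval z F G := by
  have e1 : ∀ g, iterΔ t.sF F (z + t.x) g = iterΔ s F (z + a + t.x) g - iterΔ s F (z + t.x) g := by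
    intro g; rw [h, iterΔ_cons, iterΔ_fdiffB, fdiffB_apply, add_right_comm z t.x a]
  have e2 : ∀ f, iterΔ (a :: t.sG) G (z + t.y) f = iterΔ t.sG G (z + a + t.y) f - iterΔ t.sG G (z + t.y) f := by
    intro f; rw [iterΔ_cons, iterΔ_fdiffB, fdiffB_apply, add_right_comm z t.y a]
  simp only [VTerm.eval]
  have e3 : z + (t.x + a) = z + a + t.x := by rw [← add_assoc, add_right_comm]
  rw [e3, ← mul_sub, ← mul_sub]
  congr 1
  rw [← sum_sub_distrib, ← sum_sub_distrib]
  refine sum_congr rfl fun g _ => ?_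
  rw [← sum_sub_distrib, ← sum_sub_distrib]
  refine sum_congr rfl fun f _ => ?_
  rw [e1 g, e2 f]
  ring

/-- [folklore] Negating the coefficient negates the evaluation. -/
theorem eval_neg_c (t : VTerm I) (z : Pt) (F G : Pt → I → ℝ) : ({ t with c := -t.c } : VTerm I).eval z F G = -t.eval z F G := by
  simp only [VTerm.eval, neg_mul]

omit [Fintype I] in
/-- [folklore] The length of a term with the row step moved to the column end. -/
theorem len_move (t : VTerm I) (a : Pt) (s : List Pt) (h : t.sF = a :: s) :
    ({ t with x := t.x + a, sF := s, sG := a :: t.sG } : VTerm I).len = t.len := by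
  simp only [VTerm.len, h, List.length_cons]; omega

omit [Fintype I] in
/-- [folklore] The length of a term with one row step removed. -/
theorem len_drop (t : VTerm I) (a : Pt) (s : List Pt) (h : t.sF = a :: s) : ({ t with sF := s } : VTerm I).len + 1 = t.len := by
  simp only [VTerm.len, h, List.length_cons]; omega

end Surgery

/-! ## §2 The column-good normal form of a list of grading 1 -/

section NormalForm

/-- [folklore] **COLUMN-GOOD NORMAL FORM OF A TERM LIST**: a list of unfolded terms, each with at least one unit step, rewrites (for all base points and
end functions at once) as DIRECT terms each carrying a COLUMN step plus BY-PARTS pairs `(a, t)` contributing `t.eval (z+a) − t.eval z`; all steps unit,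
and the `2^{len}`-weights are controlled: direct terms keep `len`, by-parts terms have `len + 1 =` the original. -/
theorem colGood_of_terms (Ts : List (VTerm I)) (hTs : ∀ t ∈ Ts, 1 ≤ t.len ∧ (∀ a ∈ t.sF, IsStep a) ∧ (∀ a ∈ t.sG, IsStep a)) :
    ∃ (Ds : List (VTerm I)) (Bs : List (Pt × VTerm I)),
      (∀ t ∈ Ds, t.sG ≠ [] ∧ (∀ a ∈ t.sF, IsStep a) ∧ (∀ a ∈ t.sG, IsStep a)) ∧
      (∀ p ∈ Bs, IsStep p.1 ∧ (∀ a ∈ p.2.sF, IsStep a) ∧ (∀ a ∈ p.2.sG, IsStep a)) ∧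
      (Ds.map fun t => |t.c| * (∑ g, ∑ f, |t.m g f|) * (2 : ℝ) ^ t.len).sum
        + (Bs.map fun p => |p.2.c| * (∑ g, ∑ f, |p.2.m g f|) * (2 : ℝ) ^ (p.2.len + 1)).sum
        ≤ (Ts.map fun t => |t.c| * (∑ g, ∑ f, |t.m g f|) * (2 : ℝ) ^ (t.len + 1)).sum ∧
      (∀ t ∈ Ds, ∃ t' ∈ Ts, supNorm t.x ≤ supNorm t'.x + 1 ∧ t.y = t'.y ∧ t.sF.length ≤ t'.sF.length ∧ t.sG.length ≤ t'.sG.length + 1) ∧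
      (∀ p ∈ Bs, ∃ t' ∈ Ts, p.2.x = t'.x ∧ p.2.y = t'.y ∧ p.2.sF.length ≤ t'.sF.length ∧ p.2.sG.length ≤ t'.sG.length) ∧
      ∀ (z : Pt) (F G : Pt → I → ℝ), (Ts.map fun t => t.eval z F G).sum
        = (Ds.map fun t => t.eval z F G).sum + (Bs.map fun p => p.2.eval (z + p.1) F G - p.2.eval z F G).sum := by
  induction Ts with
  | nil =>
    exact ⟨[], [], fun t ht => by simp at ht, fun p hp => by simp at hp, by simp, fun t ht => by simp at ht, fun p hp => by simp at hp,
      fun z F G => by simp⟩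
  | cons t Ts ih =>
    obtain ⟨Ds, Bs, hDs, hBs, hwt, hreachD, hreachB, hev⟩ := ih fun t' ht' => hTs t' (List.mem_cons_of_mem _ ht')
    obtain ⟨hlen, hsF, hsG⟩ := hTs t List.mem_cons_self
    have hwt0 : |t.c| * (∑ g, ∑ f, |t.m g f|) * (2 : ℝ) ^ t.len ≤ |t.c| * (∑ g, ∑ f, |t.m g f|) * (2 : ℝ) ^ (t.len + 1) :=
      mul_le_mul_of_nonneg_left (pow_le_pow_right₀ (by norm_num) (Nat.le_succ _))
        (mul_nonneg (abs_nonneg _) (sum_nonneg fun _ _ => sum_nonneg fun _ _ => abs_nonneg _))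
    by_cases hG : t.sG = []
    · -- all steps on the row end: move the first one
      obtain ⟨a, s, hFs⟩ : ∃ a s, t.sF = a :: s := by
        rcases hF : t.sF with _ | ⟨a, s⟩
        · exfalso; simp [VTerm.len, hF, hG] at hlen
        · exact ⟨a, s, rfl⟩
      have ha : IsStep a := hsF a (by rw [hFs]; exact List.mem_cons_self)
      have hs : ∀ b ∈ s, IsStep b := fun b hb => hsF b (by rw [hFs]; exact List.mem_cons_of_mem _ hb)
      set tflat : VTerm I := { t with sF := s } with htflat
      set tneg : VTerm I := { t with c := -t.c, x := t.x + a, sF := s, sG := a :: t.sG } with htneg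
      refine ⟨tneg :: Ds, (a, tflat) :: Bs, ?_, ?_, ?_, ?_, ?_, fun z F G => ?_⟩
      · intro t' ht'
        rcases List.mem_cons.1 ht' with rfl | ht'
        · exact ⟨by simp [htneg], hs, fun b hb => by
            rcases List.mem_cons.1 hb with rfl | hb
            · exact ha
            · exact hsG b hb⟩
        · exact hDs t' ht'
      · intro p hp
        rcases List.mem_cons.1 hp with rfl | hp
        · exact ⟨ha, hs, hsG⟩
        · exact hBs p hp
      · simp only [List.map_cons, List.sum_cons]
        have e1 : |tneg.c| * (∑ g, ∑ f, |tneg.m g f|) * (2 : ℝ) ^ tneg.len = |t.c| * (∑ g, ∑ f, |t.m g f|) * (2 : ℝ) ^ t.len := by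
          have : tneg.len = t.len := by simp only [htneg, VTerm.len, hFs, List.length_cons]; omega
          rw [this]; simp [htneg]
        have e2 : |tflat.c| * (∑ g, ∑ f, |tflat.m g f|) * (2 : ℝ) ^ (tflat.len + 1) = |t.c| * (∑ g, ∑ f, |t.m g f|) * (2 : ℝ) ^ t.len := by
          have : tflat.len + 1 = t.len := by simp only [htflat, VTerm.len, hFs, List.length_cons]; omega
          rw [this]
        rw [e1, e2]
        have e3 : |t.c| * (∑ g, ∑ f, |t.m g f|) * (2 : ℝ) ^ (t.len + 1) = 2 * (|t.c| * (∑ g, ∑ f, |t.m g f|) * (2 : ℝ) ^ t.len) := by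
          rw [pow_succ]; ring
        rw [e3]; linarith
      · intro t' ht'
        rcases List.mem_cons.1 ht' with rfl | ht'
        · refine ⟨t, List.mem_cons_self, ?_, rfl, ?_, ?_⟩
          · simp only [htneg]
            calc supNorm (t.x + a) ≤ supNorm t.x + supNorm a := by exact_mod_cast BlockLegs.supNorm_add_le_real _ _
              _ = supNorm t.x + 1 := by rw [ha.supNorm_eq]
          · simp [htneg, hFs]
          · simp [htneg]
        · obtain ⟨t'', ht'', h1, h2, h3, h4⟩ := hreachD t' ht'
          exact ⟨t'', List.mem_cons_of_mem _ ht'', h1, h2, h3, h4⟩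
      · intro p hp
        rcases List.mem_cons.1 hp with rfl | hp
        · exact ⟨t, List.mem_cons_self, rfl, rfl, by simp [htflat, hFs], le_rfl⟩
        · obtain ⟨t'', ht'', h1, h2, h3, h4⟩ := hreachB p hp
          exact ⟨t'', List.mem_cons_of_mem _ ht'', h1, h2, h3, h4⟩
      · simp only [List.map_cons, List.sum_cons]
        rw [hev z F G, eval_eq_of_sF_cons t hFs z F G]
        have e4 : tneg.eval z F G = -({ t with x := t.x + a, sF := s, sG := a :: t.sG } : VTerm I).eval z F G := by
          rw [← eval_neg_c]
        rw [e4]; ring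
    · -- a column step is present: direct term
      refine ⟨t :: Ds, Bs, ?_, hBs, ?_, ?_, ?_, fun z F G => ?_⟩
      · intro t' ht'
        rcases List.mem_cons.1 ht' with rfl | ht'
        · exact ⟨hG, hsF, hsG⟩
        · exact hDs t' ht'
      · simp only [List.map_cons, List.sum_cons]; linarith
      · intro t' ht'
        rcases List.mem_cons.1 ht' with rfl | ht'
        · exact ⟨t', List.mem_cons_self, Nat.le_succ _, rfl, le_rfl, Nat.le_succ _⟩
        · obtain ⟨t'', ht'', h1, h2, h3, h4⟩ := hreachD t' ht'
          exact ⟨t'', List.mem_cons_of_mem _ ht'', h1, h2, h3, h4⟩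
      · intro p hp
        obtain ⟨t'', ht'', h1, h2, h3, h4⟩ := hreachB p hp
        exact ⟨t'', List.mem_cons_of_mem _ ht'', h1, h2, h3, h4⟩
      · simp only [List.map_cons, List.sum_cons]
        rw [hev z F G]; ring

end NormalForm

/-! ## §3 Bounds from window VALUES: the bad end is never differentiated -/

section Bounds

variable (z : Pt) (R : ℕ)

omit [Fintype I] in
/-- [folklore] **ITERATED UNIT DIFFERENCES FROM VALUE BOUNDS**: `|Δ_s F (q)| ≤ 2^{|s|}·Φ₀` at window level `k + |s|` from `|F| ≤ Φ₀` at level `k`. -/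
theorem abs_iterΔ_le_pow_sup (s : List Pt) (hs : ∀ b ∈ s, IsStep b) :
    ∀ (F : Pt → I → ℝ) (Φ₀ : ℝ) (k : ℕ), (∀ (t : Pt) (g : I), supNorm (t - z) + k ≤ R → |F t g| ≤ Φ₀) →
      ∀ (q : Pt) (g : I), supNorm (q - z) + k + s.length ≤ R → |iterΔ s F q g| ≤ 2 ^ s.length * Φ₀ := by
  induction s with
  | nil =>
    intro F Φ₀ k hF q g hq
    rw [iterΔ_nil, List.length_nil, pow_zero, one_mul]
    exact hF q g (by simpa using hq)
  | cons a s ih =>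
    intro F Φ₀ k hF q g hq
    have ha : IsStep a := hs a List.mem_cons_self
    have hs' : ∀ b ∈ s, IsStep b := fun b hb => hs b (List.mem_cons_of_mem _ hb)
    have hF' : ∀ (t : Pt) (g : I), supNorm (t - z) + (k + 1) ≤ R → |fdiffB a F t g| ≤ 2 * Φ₀ := by
      intro t g' ht
      have hmove := supNorm_add_step_sub_le ha t z
      rw [fdiffB_apply]
      calc |F (t + a) g' - F t g'| ≤ |F (t + a) g'| + |F t g'| := abs_sub _ _
        _ ≤ Φ₀ + Φ₀ := add_le_add (hF _ g' (by omega)) (hF t g' (by omega))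
        _ = 2 * Φ₀ := by ring
    rw [iterΔ_cons]
    have hq' : supNorm (q - z) + (k + 1) + s.length ≤ R := by simp only [List.length_cons] at hq; omega
    calc |iterΔ s (fdiffB a F) q g| ≤ 2 ^ s.length * (2 * Φ₀) := ih hs' (fdiffB a F) (2 * Φ₀) (k + 1) hF' q g hq'
      _ = 2 ^ (a :: s).length * Φ₀ := by rw [List.length_cons, pow_succ]; ring

/-- [folklore] **ANY TERM FROM VALUE BOUNDS**: `|t.eval z F G| ≤ |c|·(Σ|m|)·2^{len}·(Φ₀·Γ₀)` (all steps unit, the term's reach inside the window). -/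
theorem abs_eval_le_sup (t : VTerm I) (hsF : ∀ a ∈ t.sF, IsStep a) (hsG : ∀ a ∈ t.sG, IsStep a)
    (hRx : supNorm t.x + t.sF.length ≤ R) (hRy : supNorm t.y + t.sG.length ≤ R)
    {F G : Pt → I → ℝ} {Φ₀ Γ₀ : ℝ} (hΦ₀ : 0 ≤ Φ₀)
    (hF₀ : ∀ (q : Pt) (g : I), supNorm (q - z) ≤ R → |F q g| ≤ Φ₀) (hG₀ : ∀ (q : Pt) (f : I), supNorm (q - z) ≤ R → |G q f| ≤ Γ₀) :
    |t.eval z F G| ≤ |t.c| * (∑ g, ∑ f, |t.m g f|) * 2 ^ t.len * (Φ₀ * Γ₀) := by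
  have hx0 : supNorm (z + t.x - z) = supNorm t.x := by rw [add_sub_cancel_left]
  have hy0 : supNorm (z + t.y - z) = supNorm t.y := by rw [add_sub_cancel_left]
  have hX : ∀ g, |iterΔ t.sF F (z + t.x) g| ≤ 2 ^ t.sF.length * Φ₀ := fun g =>
    abs_iterΔ_le_pow_sup z R t.sF hsF F Φ₀ 0 (fun q g hq => hF₀ q g (by omega)) _ g (by rw [hx0]; omega)
  have hY : ∀ f, |iterΔ t.sG G (z + t.y) f| ≤ 2 ^ t.sG.length * Γ₀ := fun f =>
    abs_iterΔ_le_pow_sup z R t.sG hsG G Γ₀ 0 (fun q f hq => hG₀ q f (by omega)) _ f (by rw [hy0]; omega)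
  rw [VTerm.eval, abs_mul]
  calc |t.c| * |∑ g, ∑ f, t.m g f * iterΔ t.sF F (z + t.x) g * iterΔ t.sG G (z + t.y) f|
      ≤ |t.c| * ((∑ g, ∑ f, |t.m g f|) * (2 ^ t.sF.length * Φ₀) * (2 ^ t.sG.length * Γ₀)) :=
        mul_le_mul_of_nonneg_left (abs_sum_sum_mul_mul_le t.m (by positivity) hX hY) (abs_nonneg _)
    _ = |t.c| * (∑ g, ∑ f, |t.m g f|) * 2 ^ t.len * (Φ₀ * Γ₀) := by rw [VTerm.len, pow_add]; ring

/-- [folklore] **A TERM WITH A COLUMN STEP FROM VALUE BOUNDS OF THE ROW END AND THE UNIT-DIFFERENCE BOUND OF THE COLUMN END**: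
`|t.eval z F G| ≤ |c|·(Σ|m|)·2^{len}·(Φ₀·Γ₁)` — the row end's own steps are absorbed by `2^k·Φ₀`; `Φ₁` is never used. -/
theorem abs_eval_le_colStep (t : VTerm I) (hne : t.sG ≠ []) (hsF : ∀ a ∈ t.sF, IsStep a) (hsG : ∀ a ∈ t.sG, IsStep a)
    (hRx : supNorm t.x + t.sF.length ≤ R) (hRy : supNorm t.y + 2 * t.sG.length ≤ R)
    {F G : Pt → I → ℝ} {Φ₀ Γ₁ : ℝ} (hΦ₀ : 0 ≤ Φ₀) (hΓ₁ : 0 ≤ Γ₁)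
    (hF₀ : ∀ (q : Pt) (g : I), supNorm (q - z) ≤ R → |F q g| ≤ Φ₀)
    (hG₁ : ∀ (q : Pt) (f : I) (i : Fin 4), supNorm (q - z) ≤ R → |G (q + unitVec i) f - G q f| ≤ Γ₁) :
    |t.eval z F G| ≤ |t.c| * (∑ g, ∑ f, |t.m g f|) * 2 ^ t.len * (Φ₀ * Γ₁) := by
  obtain ⟨b, s', hG⟩ : ∃ b s', t.sG = b :: s' := by
    rcases h : t.sG with _ | ⟨b, s'⟩
    · exact absurd h hne
    · exact ⟨b, s', rfl⟩
  have hb : IsStep b := hsG b (by rw [hG]; exact List.mem_cons_self)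
  have hs' : ∀ b' ∈ s', IsStep b' := fun b' hb' => hsG b' (by rw [hG]; exact List.mem_cons_of_mem _ hb')
  have hx0 : supNorm (z + t.x - z) = supNorm t.x := by rw [add_sub_cancel_left]
  have hy0 : supNorm (z + t.y - z) = supNorm t.y := by rw [add_sub_cancel_left]
  have hX : ∀ g, |iterΔ t.sF F (z + t.x) g| ≤ 2 ^ t.sF.length * Φ₀ := fun g =>
    abs_iterΔ_le_pow_sup z R t.sF hsF F Φ₀ 0 (fun q g hq => hF₀ q g (by omega)) _ g (by rw [hx0]; omega)
  have hY : ∀ f, |iterΔ t.sG G (z + t.y) f| ≤ 2 ^ s'.length * Γ₁ := fun f => by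
    rw [hG]
    exact abs_iterΔ_cons_le z R s' hs' hb G Γ₁ 0 (fun q f i hq => hG₁ q f i (by omega)) _ f
      (by rw [hy0]; rw [hG, List.length_cons] at hRy; omega)
  have hlen : t.len = t.sF.length + (s'.length + 1) := by simp [VTerm.len, hG]
  rw [VTerm.eval, abs_mul]
  calc |t.c| * |∑ g, ∑ f, t.m g f * iterΔ t.sF F (z + t.x) g * iterΔ t.sG G (z + t.y) f|
      ≤ |t.c| * ((∑ g, ∑ f, |t.m g f|) * (2 ^ t.sF.length * Φ₀) * (2 ^ s'.length * Γ₁)) :=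
        mul_le_mul_of_nonneg_left (abs_sum_sum_mul_mul_le t.m (by positivity) hX hY) (abs_nonneg _)
    _ = |t.c| * (∑ g, ∑ f, |t.m g f|) * 2 ^ (t.sF.length + s'.length) * (Φ₀ * Γ₁) := by rw [pow_add]; ring
    _ ≤ |t.c| * (∑ g, ∑ f, |t.m g f|) * 2 ^ t.len * (Φ₀ * Γ₁) := by
        have hm : 0 ≤ |t.c| * (∑ g, ∑ f, |t.m g f|) := mul_nonneg (abs_nonneg _) (sum_nonneg fun _ _ => sum_nonneg fun _ _ => abs_nonneg _)
        have hpow : (2 : ℝ) ^ (t.sF.length + s'.length) ≤ 2 ^ t.len := pow_le_pow_right₀ (by norm_num) (by omega)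
        have := mul_le_mul_of_nonneg_left (mul_le_mul_of_nonneg_right hpow (mul_nonneg hΦ₀ hΓ₁)) hm
        linarith [this]

end Bounds

end Summit.QuantumFields.BalabanUV.Beta.D1BFx.LocalVertexByParts

end
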